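import Literature.Computability.AlgebraicComplexity.ConstituentStageData
import Literature.Computability.AlgebraicComplexity.FirstTypeHoleBound
import HarnessLib

/-!
# The holes of the first type of `𝒯*` are exponentially few
(Vassilevska Williams–Xu–Xu–Zhou 2024, §6.6: "the fraction of holes caused by the complete split
distributions enforced in the input is `1 − 1/n²` for the `X`-dimension. By symmetry, the same also
holds for the `Y`- and `Z`-dimensions") — proved

Topic `Literature/Computability/AlgebraicComplexity`.  This file instantiates the abstract bound of
`FirstTypeHoleBound.lean` (`card_mergedHoles_le`) to the tensor `𝒯*` of the constituent stage of
Vassilevska Williams–Xu–Xu–Zhou, *New bounds for matrix multiplication: from alpha to omega* (SODA 2024,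
arXiv:2307.07970), §6.5–§6.6, as set up in `ConstituentStageData.lean`: the finer term map is the pair
term map `p ↦ (t(p), (I_p, J_p, K_p))` of a level-`(ℓ−1)` block triple `(I, J, K)` inside the level-`ℓ`
blocks, its classes are the `S_{t,i',j',k'}`, the right class of a chunk of left class `(t,(i',j',k'))`
is `(t, (i_t−i', j_t−j', k_t−k'))` (`starBar`), and the level-`ℓ` split distribution of the input on
term `t` is the mixture of eq. (14), `β_{X,t} = ∑_{(i',j',k')} α_t(i',j',k') · β_{X,t,i'j'k'} × β_{X,t,i_t−i',j_t−j',k_t−k'}`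
with the realised proportions `α_t(i',j',k') = #left(t,(i',j',k'))/n_t`:

* `pairTermList_pairTermIdx_i/j/k/γX/γY/γZ` — the data of `𝒯*` at a position;
* `starBar`, `pairTermIdx_natAdd_eq_starBar` — the right class of a chunk is determined by its term and
  left class;
* `leftProbes_pairTermIdx_eq` — the groups of chunks of `FirstTypeHoleBound` are the left classes
  `left(t,(i',j',k'))` of `ConstituentStageData` ("`A_{t,1} · α_t(i',j',k') · n_t` such positions");
* `splitMixture_mul_card_eq_sum` — eq. (14) in the form consumed by the abstract bound;
* `card_firstTypeHolesX_le`, `card_firstTypeHolesX_le_of_le` (and `Y`, `Z`) — **the holes of the first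
  type in each dimension are at most `(∑_{(t,g)} holePoly(c,n) e^{−m_{t,g} ε²/32}) ·` (all level-1 blocks
  of `𝒯*` in that dimension)**, resp. `≤ s · (s·#{i'+j'+k'=2c}) · holePoly(c,n) · e^{−m₀ ε²/32} ·` (all
  blocks) when every inhabited left class has at least `m₀` chunks — "`≤ 1/n²`" of the blocks for `n`
  large, as `m₀ = min α_t(i',j',k') A_{t,1} n_t = Θ(n)` in Prop. 6.2.

Everything is proved; the definitions are `complTriple` and `starBar`; no named facts.

## References

* V. Vassilevska Williams, Y. Xu, Z. Xu, R. Zhou, *New bounds for matrix multiplication: from alpha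
  to omega*, SODA 2024, arXiv:2307.07970 (held: `paper:arxiv-2307.07970`), §6.5 (the first type of
  holes), §6.6 (first four paragraphs), Prop. 6.2 (eq. (14)). [VassilevskaWilliamsXuXuZhou2024]
-/

noncomputable section

open scoped BigOperators
open Finset

namespace Literature.Computability.AlgebraicComplexity

variable {c n s : ℕ} (τ : Fin n → Fin s) (L : Fin s → InterfaceTerm (c + c))

/-! ## The data of `𝒯*` at a position -/

section Data

variable {I J K : Fin (n + n) → ℕ} (h : IsLevelTriple c I J K)

omit L in
/-- The pair term index of a left half. [folklore] -/
theorem pairTermIdx_castAdd (u : Fin n) :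
    pairTermIdx τ h (Fin.castAdd n u) = finProdFinEquiv (τ u, tripleTermMap h (Fin.castAdd n u)) := by
  show finProdFinEquiv (halfTermOf τ (Fin.castAdd n u), _) = _
  rw [halfTermOf_castAdd]

omit L in
/-- The pair term index of a right half. [folklore] -/
theorem pairTermIdx_natAdd (u : Fin n) :
    pairTermIdx τ h (Fin.natAdd n u) = finProdFinEquiv (τ u, tripleTermMap h (Fin.natAdd n u)) := by
  show finProdFinEquiv (halfTermOf τ (Fin.natAdd n u), _) = _
  rw [halfTermOf_natAdd]

omit L in
/-- The term of `𝒯*` at position `p`. [cite: VassilevskaWilliamsXuXuZhou2024, §6.5 (𝒯*)] -/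
theorem pairTermList_pairTermIdx (βX βY βZ : Fin s → ℕ × ℕ × ℕ → (Fin c → Fin 3) → ℝ) (p : Fin (n + n)) :
    pairTermList c s βX βY βZ (pairTermIdx τ h p) =
      ⟨I p, J p, K p, βX (halfTermOf τ p) (I p, J p, K p), βY (halfTermOf τ p) (I p, J p, K p),
        βZ (halfTermOf τ p) (I p, J p, K p)⟩ := by
  rw [show pairTermIdx τ h p = finProdFinEquiv (halfTermOf τ p, tripleTermMap h p) from rfl, pairTermList_apply]
  simp [tripleTermMap]

omit L in
/-- The `X`-degree of `𝒯*` at position `p` is `I_p`. [cite: VassilevskaWilliamsXuXuZhou2024, §6.5] -/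
theorem pairTermList_pairTermIdx_i (βX βY βZ : Fin s → ℕ × ℕ × ℕ → (Fin c → Fin 3) → ℝ) (p : Fin (n + n)) :
    (pairTermList c s βX βY βZ (pairTermIdx τ h p)).i = I p := by
  rw [pairTermList_pairTermIdx]

omit L in
/-- The `Y`-degree of `𝒯*` at position `p` is `J_p`. [cite: VassilevskaWilliamsXuXuZhou2024, §6.5] -/
theorem pairTermList_pairTermIdx_j (βX βY βZ : Fin s → ℕ × ℕ × ℕ → (Fin c → Fin 3) → ℝ) (p : Fin (n + n)) :
    (pairTermList c s βX βY βZ (pairTermIdx τ h p)).j = J p := by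
  rw [pairTermList_pairTermIdx]

omit L in
/-- The `Z`-degree of `𝒯*` at position `p` is `K_p`. [cite: VassilevskaWilliamsXuXuZhou2024, §6.5] -/
theorem pairTermList_pairTermIdx_k (βX βY βZ : Fin s → ℕ × ℕ × ℕ → (Fin c → Fin 3) → ℝ) (p : Fin (n + n)) :
    (pairTermList c s βX βY βZ (pairTermIdx τ h p)).k = K p := by
  rw [pairTermList_pairTermIdx]

omit L h in
/-- The `X`-distribution of the term `(t, (i',j',k'))`. [cite: VassilevskaWilliamsXuXuZhou2024, §6.5] -/
theorem pairTermList_γX_apply (βX βY βZ : Fin s → ℕ × ℕ × ℕ → (Fin c → Fin 3) → ℝ) (t : Fin s)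
    (sidx : Fin (constituentTriples c).card) :
    (pairTermList c s βX βY βZ (finProdFinEquiv (t, sidx))).γX = βX t ((constituentTriples c).equivFin.symm sidx).1 := by
  rw [pairTermList_apply]

omit L h in
/-- The `Y`-distribution of the term `(t, (i',j',k'))`. [cite: VassilevskaWilliamsXuXuZhou2024, §6.5] -/
theorem pairTermList_γY_apply (βX βY βZ : Fin s → ℕ × ℕ × ℕ → (Fin c → Fin 3) → ℝ) (t : Fin s)
    (sidx : Fin (constituentTriples c).card) :
    (pairTermList c s βX βY βZ (finProdFinEquiv (t, sidx))).γY = βY t ((constituentTriples c).equivFin.symm sidx).1 := by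
  rw [pairTermList_apply]

omit L h in
/-- The `Z`-distribution of the term `(t, (i',j',k'))`. [cite: VassilevskaWilliamsXuXuZhou2024, §6.5] -/
theorem pairTermList_γZ_apply (βX βY βZ : Fin s → ℕ × ℕ × ℕ → (Fin c → Fin 3) → ℝ) (t : Fin s)
    (sidx : Fin (constituentTriples c).card) :
    (pairTermList c s βX βY βZ (finProdFinEquiv (t, sidx))).γZ = βZ t ((constituentTriples c).equivFin.symm sidx).1 := by
  rw [pairTermList_apply]

end Data

/-! ## The right class of a chunk -/

section Bar

omit τ in
/-- The complementary split type in term `T`: `(i',j',k') ↦ (i − i', j − j', k − k')`. [cite: VassilevskaWilliamsXuXuZhou2024, §6 (preamble: (l_X, i_t − l_X))] -/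
abbrev complTriple (T : InterfaceTerm (c + c)) (ijk : ℕ × ℕ × ℕ) : ℕ × ℕ × ℕ := (T.i - ijk.1, T.j - ijk.2.1, T.k - ijk.2.2)

/-- **The right class as a function of the term and the left class**: `(t', (i',j',k')) ↦ (t, (i_t−i', j_t−j', k_t−k'))`
(when the latter is a constituent triple; otherwise, irrelevantly, the class itself).
[cite: VassilevskaWilliamsXuXuZhou2024, §6.6 ("the second half-chunk, which corresponds to (i_t − i', j_t − j', k_t − k')")] -/
def starBar (t : Fin s) (g : Fin (s * (constituentTriples c).card)) : Fin (s * (constituentTriples c).card) :=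
  if hm : complTriple (L t) ((constituentTriples c).equivFin.symm (finProdFinEquiv.symm g).2).1 ∈ constituentTriples c then
    finProdFinEquiv (t, (constituentTriples c).equivFin
      ⟨complTriple (L t) ((constituentTriples c).equivFin.symm (finProdFinEquiv.symm g).2).1, hm⟩)
  else g

omit τ in
/-- `starBar` on a class whose complement is a constituent triple. [folklore] -/
theorem starBar_of_mem (t t' : Fin s) (sidx : Fin (constituentTriples c).card)
    (hm : complTriple (L t) ((constituentTriples c).equivFin.symm sidx).1 ∈ constituentTriples c) :
    starBar L t (finProdFinEquiv (t', sidx)) =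
      finProdFinEquiv (t, (constituentTriples c).equivFin ⟨complTriple (L t) ((constituentTriples c).equivFin.symm sidx).1, hm⟩) := by
  unfold starBar
  simp only [Equiv.symm_apply_apply]
  rw [dif_pos hm]

omit τ in
/-- `starBar` on a class whose complement is not a constituent triple. [folklore] -/
theorem starBar_of_not_mem (t t' : Fin s) (sidx : Fin (constituentTriples c).card)
    (hm : complTriple (L t) ((constituentTriples c).equivFin.symm sidx).1 ∉ constituentTriples c) :
    starBar L t (finProdFinEquiv (t', sidx)) = finProdFinEquiv (t', sidx) := by
  unfold starBar
  simp only [Equiv.symm_apply_apply]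
  rw [dif_neg hm]

variable {I J K : Fin (n + n) → ℕ} (h : IsLevelTriple c I J K)

/-- **For a triple inside the level-`ℓ` blocks, the right half of a chunk lies in the class `starBar` of
its term and left class.** [cite: VassilevskaWilliamsXuXuZhou2024, §6.6 (first type of holes, second paragraph)] -/
theorem pairTermIdx_natAdd_eq_starBar (hI : ∀ u, I (Fin.castAdd n u) + I (Fin.natAdd n u) = (L (τ u)).i)
    (hJ : ∀ u, J (Fin.castAdd n u) + J (Fin.natAdd n u) = (L (τ u)).j)
    (hK : ∀ u, K (Fin.castAdd n u) + K (Fin.natAdd n u) = (L (τ u)).k) (u : Fin n) :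
    pairTermIdx τ h (Fin.natAdd n u) = starBar L (τ u) (pairTermIdx τ h (Fin.castAdd n u)) := by
  rw [pairTermIdx_natAdd, pairTermIdx_castAdd]
  have h1 : (L (τ u)).i - I (Fin.castAdd n u) = I (Fin.natAdd n u) := by have := hI u; omega
  have h2 : (L (τ u)).j - J (Fin.castAdd n u) = J (Fin.natAdd n u) := by have := hJ u; omega
  have h3 : (L (τ u)).k - K (Fin.castAdd n u) = K (Fin.natAdd n u) := by have := hK u; omega
  have hmem : (I (Fin.natAdd n u), J (Fin.natAdd n u), K (Fin.natAdd n u)) ∈ constituentTriples c :=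
    (mem_constituentTriples c).2 (h _)
  have hc : complTriple (L (τ u)) ((constituentTriples c).equivFin.symm (tripleTermMap h (Fin.castAdd n u))).1 =
      (I (Fin.natAdd n u), J (Fin.natAdd n u), K (Fin.natAdd n u)) := by
    simp only [tripleTermMap, Equiv.symm_apply_apply, complTriple, h1, h2, h3]
  have hm : complTriple (L (τ u)) ((constituentTriples c).equivFin.symm (tripleTermMap h (Fin.castAdd n u))).1 ∈
      constituentTriples c := by rw [hc]; exact hmem
  rw [starBar_of_mem L (τ u) (τ u) _ hm]
  congr 2
  rw [tripleTermMap]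
  congr 1
  exact Subtype.ext hc.symm

/-- **The groups of chunks are the left classes**: the chunks of term `t` whose left half lies in the class
`(t', (i',j',k'))` are the chunks of left type `(i',j',k')` of term `t` if `t' = t`, none otherwise.
[cite: VassilevskaWilliamsXuXuZhou2024, §6.6 ("there are A_{t,1} · α_t(i',j',k') · n_t such positions")] -/
theorem leftProbes_pairTermIdx_eq (t t' : Fin s) (sidx : Fin (constituentTriples c).card) :
    leftProbes τ (pairTermIdx τ h) t (finProdFinEquiv (t', sidx)) =
      if t' = t then leftClass τ I J K t ((constituentTriples c).equivFin.symm sidx).1.1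
        ((constituentTriples c).equivFin.symm sidx).1.2.1 ((constituentTriples c).equivFin.symm sidx).1.2.2 else ∅ := by
  ext u
  simp only [mem_filter, mem_univ, true_and, pairTermIdx_castAdd, EmbeddingLike.apply_eq_iff_eq, Prod.mk.injEq]
  have htm : tripleTermMap h (Fin.castAdd n u) = sidx ↔
      I (Fin.castAdd n u) = ((constituentTriples c).equivFin.symm sidx).1.1 ∧
        J (Fin.castAdd n u) = ((constituentTriples c).equivFin.symm sidx).1.2.1 ∧
          K (Fin.castAdd n u) = ((constituentTriples c).equivFin.symm sidx).1.2.2 := by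
    have := Finset.ext_iff.1 (filter_tripleTermMap_eq h sidx) (Fin.castAdd n u)
    simpa using this
  split_ifs with htt
  · subst htt
    rw [mem_leftClass, htm]
    tauto
  · simp only [Finset.notMem_empty, iff_false, not_and]
    intro hu ht'
    exact absurd (ht'.symm.trans hu) htt

/-- A uniform lower bound on the inhabited left classes is one on the inhabited groups. [folklore] -/
theorem le_card_leftProbes_of_le_card_leftClass (m₀ : ℕ)
    (hm₀ : ∀ t i j k, 0 < (leftClass τ I J K t i j k).card → m₀ ≤ (leftClass τ I J K t i j k).card)
    (t : Fin s) (g : Fin (s * (constituentTriples c).card)) (hg : 0 < (leftProbes τ (pairTermIdx τ h) t g).card) :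
    m₀ ≤ (leftProbes τ (pairTermIdx τ h) t g).card := by
  obtain ⟨⟨t', sidx⟩, rfl⟩ := finProdFinEquiv.surjective g
  rw [leftProbes_pairTermIdx_eq] at hg ⊢
  split_ifs at hg ⊢ with htt
  · exact hm₀ _ _ _ _ hg
  · simp at hg

/-- **Eq. (14) in the form consumed by the abstract bound**: if `γ_t` is the mixture
`∑_{(i',j',k')} (#left(t,(i',j',k'))/n_t) · β_{t,i'j'k'} × β_{t,i_t−i',j_t−j',k_t−k'}` then
`γ_t(σ) · n_t = ∑_g m_{t,g} · β'_g(left σ) · β'_{starBar(t,g)}(right σ)` for the flattened data `β'`.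
[cite: VassilevskaWilliamsXuXuZhou2024, Prop. 6.2 (eq. (14)) and §6.6 ("Summing over all i', j', k'")] -/
theorem splitMixture_mul_card_eq_sum (hI : ∀ u, I (Fin.castAdd n u) + I (Fin.natAdd n u) = (L (τ u)).i)
    (hJ : ∀ u, J (Fin.castAdd n u) + J (Fin.natAdd n u) = (L (τ u)).j)
    (hK : ∀ u, K (Fin.castAdd n u) + K (Fin.natAdd n u) = (L (τ u)).k)
    (βW : Fin s → ℕ × ℕ × ℕ → (Fin c → Fin 3) → ℝ) (β' : Fin (s * (constituentTriples c).card) → (Fin c → Fin 3) → ℝ)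
    (hβ' : ∀ t sidx, β' (finProdFinEquiv (t, sidx)) = βW t ((constituentTriples c).equivFin.symm sidx).1)
    (t : Fin s) (ht : 0 < (termFibre τ t).card) (σ : Fin (c + c) → Fin 3) :
    splitMixture (constituentTriples c)
        (fun ijk => ((leftClass τ I J K t ijk.1 ijk.2.1 ijk.2.2).card : ℝ) / (termFibre τ t).card)
        (βW t) ((L t).i, (L t).j, (L t).k) σ * (termFibre τ t).card =
      ∑ g, ((leftProbes τ (pairTermIdx τ h) t g).card : ℝ) * β' g (leftHalf σ) * β' (starBar L t g) (rightHalf σ) := by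
  have hntR : ((termFibre τ t).card : ℝ) ≠ 0 := by exact_mod_cast ht.ne'
  -- an inhabited left class has a constituent complement
  have hcompl : ∀ ijk : ℕ × ℕ × ℕ, 0 < (leftClass τ I J K t ijk.1 ijk.2.1 ijk.2.2).card →
      complTriple (L t) ijk ∈ constituentTriples c := by
    intro ijk hpos
    obtain ⟨u, hu⟩ := card_pos.1 hpos
    rw [mem_leftClass] at hu
    obtain ⟨htu, h1, h2, h3⟩ := hu
    have e1 : (L t).i - ijk.1 = I (Fin.natAdd n u) := by have := hI u; rw [htu] at this; omega
    have e2 : (L t).j - ijk.2.1 = J (Fin.natAdd n u) := by have := hJ u; rw [htu] at this; omega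
    have e3 : (L t).k - ijk.2.2 = K (Fin.natAdd n u) := by have := hK u; rw [htu] at this; omega
    rw [complTriple, e1, e2, e3]
    exact (mem_constituentTriples c).2 (h _)
  -- the left-hand side, term by term
  have hL : splitMixture (constituentTriples c)
      (fun ijk => ((leftClass τ I J K t ijk.1 ijk.2.1 ijk.2.2).card : ℝ) / (termFibre τ t).card)
      (βW t) ((L t).i, (L t).j, (L t).k) σ * (termFibre τ t).card =
        ∑ ijk ∈ constituentTriples c, ((leftClass τ I J K t ijk.1 ijk.2.1 ijk.2.2).card : ℝ) *
          (βW t ijk (leftHalf σ) * βW t (complTriple (L t) ijk) (rightHalf σ)) := by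
    rw [splitMixture, sum_mul]
    refine sum_congr rfl fun ijk _ => ?_
    rw [splitProd_apply]
    field_simp
  -- the right-hand side, reindexed by `(t', (i',j',k'))`
  have hR : ∑ g, ((leftProbes τ (pairTermIdx τ h) t g).card : ℝ) * β' g (leftHalf σ) * β' (starBar L t g) (rightHalf σ) =
      ∑ ijk ∈ constituentTriples c, ((leftClass τ I J K t ijk.1 ijk.2.1 ijk.2.2).card : ℝ) *
        (βW t ijk (leftHalf σ) * βW t (complTriple (L t) ijk) (rightHalf σ)) := by
    rw [← finProdFinEquiv.sum_comp, Fintype.sum_prod_type, Fintype.sum_eq_single t]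
    · -- the `t`-th summand: reindex `sidx ↦ (i',j',k')`
      set e := (constituentTriples c).equivFin with he
      have hterm : ∀ sidx : Fin (constituentTriples c).card,
          ((leftProbes τ (pairTermIdx τ h) t (finProdFinEquiv (t, sidx))).card : ℝ) * β' (finProdFinEquiv (t, sidx)) (leftHalf σ) *
              β' (starBar L t (finProdFinEquiv (t, sidx))) (rightHalf σ) =
            ((leftClass τ I J K t (e.symm sidx).1.1 (e.symm sidx).1.2.1 (e.symm sidx).1.2.2).card : ℝ) *
              (βW t (e.symm sidx).1 (leftHalf σ) * βW t (complTriple (L t) (e.symm sidx).1) (rightHalf σ)) := by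
        intro sidx
        rw [leftProbes_pairTermIdx_eq, if_pos rfl, hβ']
        by_cases hm : complTriple (L t) (e.symm sidx).1 ∈ constituentTriples c
        · rw [starBar_of_mem L t t sidx hm, hβ', Equiv.symm_apply_apply]
          ring
        · have h0 : (leftClass τ I J K t (e.symm sidx).1.1 (e.symm sidx).1.2.1 (e.symm sidx).1.2.2).card = 0 := by
            by_contra hne
            exact hm (hcompl (e.symm sidx).1 (Nat.pos_of_ne_zero hne))
          rw [h0]; simp
      rw [Fintype.sum_congr _ _ hterm]
      rw [← Finset.sum_coe_sort (constituentTriples c), ← e.symm.sum_comp]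
    · intro t' ht'
      refine Fintype.sum_eq_zero _ fun sidx => ?_
      rw [leftProbes_pairTermIdx_eq, if_neg ht']
      simp
  rw [hL, hR]

end Bar

/-! ## The bounds in the three dimensions -/

section Bounds

variable {I J K : Fin (n + n) → ℕ} (h : IsLevelTriple c I J K) (ε : ℝ)
variable (βX βY βZ : Fin s → ℕ × ℕ × ℕ → (Fin c → Fin 3) → ℝ)

/-- **First-type holes, `X`-dimension**: for a level-`(ℓ−1)` triple inside the level-`ℓ` blocks and
level-`ℓ` `X`-distributions given by eq. (14) with the realised proportions, the level-1 `X`-blocks of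
`𝒯*` missing from the input `𝒯_{τ,L,ε}` are at most
`(∑_{(t,g) : m_{t,g} > 0} holePoly(c,n) e^{−m_{t,g} ε²/32}) ·` (all level-1 `X`-blocks of `𝒯*`).
[cite: VassilevskaWilliamsXuXuZhou2024, §6.6 ("a random level-1 X-block appears in 𝒯 with probability at least 1 − 1/n²")] -/
theorem card_firstTypeHolesX_le (hε : 0 < ε)
    (hI : ∀ u, I (Fin.castAdd n u) + I (Fin.natAdd n u) = (L (τ u)).i)
    (hJ : ∀ u, J (Fin.castAdd n u) + J (Fin.natAdd n u) = (L (τ u)).j)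
    (hK : ∀ u, K (Fin.castAdd n u) + K (Fin.natAdd n u) = (L (τ u)).k)
    (hmix : ∀ t, 0 < (termFibre τ t).card → (L t).γX = splitMixture (constituentTriples c)
      (fun ijk => ((leftClass τ I J K t ijk.1 ijk.2.1 ijk.2.2).card : ℝ) / (termFibre τ t).card) (βX t) ((L t).i, (L t).j, (L t).k)) :
    ((firstTypeHolesX τ L ε h βX βY βZ).card : ℝ) ≤
      (∑ t, ∑ g, if 0 < (leftProbes τ (pairTermIdx τ h) t g).card then
          holePoly c n * Real.exp (-((leftProbes τ (pairTermIdx τ h) t g).card * ε ^ 2 / 32)) else 0) *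
        (levelBlocksX (pairTermIdx τ h) (pairTermList c s βX βY βZ) 0).card := by
  have hmain := card_mergedHoles_le τ (pairTermIdx τ h) (deg := fun t => (L t).i) (γ := fun t => (L t).γX) hε
    (deg' := fun idx => (pairTermList c s βX βY βZ idx).i) (β := fun idx => (pairTermList c s βX βY βZ idx).γX)
    (bar := starBar L) (fun u => by rw [pairTermList_pairTermIdx_i, pairTermList_pairTermIdx_i, hI])
    (pairTermIdx_natAdd_eq_starBar τ L h hI hJ hK)
    (fun t ht σ => by
      rw [hmix t ht]
      exact splitMixture_mul_card_eq_sum τ L h hI hJ hK βX _ (fun t sidx => pairTermList_γX_apply βX βY βZ t sidx) t ht σ)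
  exact hmain

/-- **Uniform form, `X`-dimension**: if every inhabited left class has at least `m₀` chunks, the first-type
`X`-holes are at most `s · (s·#{i'+j'+k'=2c}) · holePoly(c,n) · e^{−m₀ε²/32} ·` (all level-1 `X`-blocks of `𝒯*`).
[cite: VassilevskaWilliamsXuXuZhou2024, §6.6 ("the 1 − 1/poly(n) probability can be bounded by 1 − 1/n² for sufficiently large n")] -/
theorem card_firstTypeHolesX_le_of_le (hε : 0 < ε)
    (hI : ∀ u, I (Fin.castAdd n u) + I (Fin.natAdd n u) = (L (τ u)).i)
    (hJ : ∀ u, J (Fin.castAdd n u) + J (Fin.natAdd n u) = (L (τ u)).j)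
    (hK : ∀ u, K (Fin.castAdd n u) + K (Fin.natAdd n u) = (L (τ u)).k)
    (hmix : ∀ t, 0 < (termFibre τ t).card → (L t).γX = splitMixture (constituentTriples c)
      (fun ijk => ((leftClass τ I J K t ijk.1 ijk.2.1 ijk.2.2).card : ℝ) / (termFibre τ t).card) (βX t) ((L t).i, (L t).j, (L t).k))
    (m₀ : ℕ) (hm₀ : ∀ t i j k, 0 < (leftClass τ I J K t i j k).card → m₀ ≤ (leftClass τ I J K t i j k).card) :
    ((firstTypeHolesX τ L ε h βX βY βZ).card : ℝ) ≤
      (s : ℝ) * (s * (constituentTriples c).card : ℕ) * holePoly c n * Real.exp (-((m₀ : ℝ) * ε ^ 2 / 32)) *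
        (levelBlocksX (pairTermIdx τ h) (pairTermList c s βX βY βZ) 0).card := by
  have hmain := card_mergedHoles_le_of_le τ (pairTermIdx τ h) (deg := fun t => (L t).i) (γ := fun t => (L t).γX) hε
    (deg' := fun idx => (pairTermList c s βX βY βZ idx).i) (β := fun idx => (pairTermList c s βX βY βZ idx).γX)
    (bar := starBar L) (fun u => by rw [pairTermList_pairTermIdx_i, pairTermList_pairTermIdx_i, hI])
    (pairTermIdx_natAdd_eq_starBar τ L h hI hJ hK)
    (fun t ht σ => by
      rw [hmix t ht]
      exact splitMixture_mul_card_eq_sum τ L h hI hJ hK βX _ (fun t sidx => pairTermList_γX_apply βX βY βZ t sidx) t ht σ)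
    m₀ (le_card_leftProbes_of_le_card_leftClass τ h m₀ hm₀)
  exact hmain

/-- **First-type holes, `Y`-dimension.** [cite: VassilevskaWilliamsXuXuZhou2024, §6.6 ("By symmetry, the same also holds for the Y- and Z-dimensions")] -/
theorem card_firstTypeHolesY_le (hε : 0 < ε)
    (hI : ∀ u, I (Fin.castAdd n u) + I (Fin.natAdd n u) = (L (τ u)).i)
    (hJ : ∀ u, J (Fin.castAdd n u) + J (Fin.natAdd n u) = (L (τ u)).j)
    (hK : ∀ u, K (Fin.castAdd n u) + K (Fin.natAdd n u) = (L (τ u)).k)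
    (hmix : ∀ t, 0 < (termFibre τ t).card → (L t).γY = splitMixture (constituentTriples c)
      (fun ijk => ((leftClass τ I J K t ijk.1 ijk.2.1 ijk.2.2).card : ℝ) / (termFibre τ t).card) (βY t) ((L t).i, (L t).j, (L t).k)) :
    ((firstTypeHolesY τ L ε h βX βY βZ).card : ℝ) ≤
      (∑ t, ∑ g, if 0 < (leftProbes τ (pairTermIdx τ h) t g).card then
          holePoly c n * Real.exp (-((leftProbes τ (pairTermIdx τ h) t g).card * ε ^ 2 / 32)) else 0) *
        (levelBlocksY (pairTermIdx τ h) (pairTermList c s βX βY βZ) 0).card := by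
  have hmain := card_mergedHoles_le τ (pairTermIdx τ h) (deg := fun t => (L t).j) (γ := fun t => (L t).γY) hε
    (deg' := fun idx => (pairTermList c s βX βY βZ idx).j) (β := fun idx => (pairTermList c s βX βY βZ idx).γY)
    (bar := starBar L) (fun u => by rw [pairTermList_pairTermIdx_j, pairTermList_pairTermIdx_j, hJ])
    (pairTermIdx_natAdd_eq_starBar τ L h hI hJ hK)
    (fun t ht σ => by
      rw [hmix t ht]
      exact splitMixture_mul_card_eq_sum τ L h hI hJ hK βY _ (fun t sidx => pairTermList_γY_apply βX βY βZ t sidx) t ht σ)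
  exact hmain

/-- **Uniform form, `Y`-dimension.** [cite: VassilevskaWilliamsXuXuZhou2024, §6.6] -/
theorem card_firstTypeHolesY_le_of_le (hε : 0 < ε)
    (hI : ∀ u, I (Fin.castAdd n u) + I (Fin.natAdd n u) = (L (τ u)).i)
    (hJ : ∀ u, J (Fin.castAdd n u) + J (Fin.natAdd n u) = (L (τ u)).j)
    (hK : ∀ u, K (Fin.castAdd n u) + K (Fin.natAdd n u) = (L (τ u)).k)
    (hmix : ∀ t, 0 < (termFibre τ t).card → (L t).γY = splitMixture (constituentTriples c)
      (fun ijk => ((leftClass τ I J K t ijk.1 ijk.2.1 ijk.2.2).card : ℝ) / (termFibre τ t).card) (βY t) ((L t).i, (L t).j, (L t).k))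
    (m₀ : ℕ) (hm₀ : ∀ t i j k, 0 < (leftClass τ I J K t i j k).card → m₀ ≤ (leftClass τ I J K t i j k).card) :
    ((firstTypeHolesY τ L ε h βX βY βZ).card : ℝ) ≤
      (s : ℝ) * (s * (constituentTriples c).card : ℕ) * holePoly c n * Real.exp (-((m₀ : ℝ) * ε ^ 2 / 32)) *
        (levelBlocksY (pairTermIdx τ h) (pairTermList c s βX βY βZ) 0).card := by
  have hmain := card_mergedHoles_le_of_le τ (pairTermIdx τ h) (deg := fun t => (L t).j) (γ := fun t => (L t).γY) hε
    (deg' := fun idx => (pairTermList c s βX βY βZ idx).j) (β := fun idx => (pairTermList c s βX βY βZ idx).γY)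
    (bar := starBar L) (fun u => by rw [pairTermList_pairTermIdx_j, pairTermList_pairTermIdx_j, hJ])
    (pairTermIdx_natAdd_eq_starBar τ L h hI hJ hK)
    (fun t ht σ => by
      rw [hmix t ht]
      exact splitMixture_mul_card_eq_sum τ L h hI hJ hK βY _ (fun t sidx => pairTermList_γY_apply βX βY βZ t sidx) t ht σ)
    m₀ (le_card_leftProbes_of_le_card_leftClass τ h m₀ hm₀)
  exact hmain

/-- **First-type holes, `Z`-dimension.** [cite: VassilevskaWilliamsXuXuZhou2024, §6.6 ("By symmetry, the same also holds for the Y- and Z-dimensions")] -/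
theorem card_firstTypeHolesZ_le (hε : 0 < ε)
    (hI : ∀ u, I (Fin.castAdd n u) + I (Fin.natAdd n u) = (L (τ u)).i)
    (hJ : ∀ u, J (Fin.castAdd n u) + J (Fin.natAdd n u) = (L (τ u)).j)
    (hK : ∀ u, K (Fin.castAdd n u) + K (Fin.natAdd n u) = (L (τ u)).k)
    (hmix : ∀ t, 0 < (termFibre τ t).card → (L t).γZ = splitMixture (constituentTriples c)
      (fun ijk => ((leftClass τ I J K t ijk.1 ijk.2.1 ijk.2.2).card : ℝ) / (termFibre τ t).card) (βZ t) ((L t).i, (L t).j, (L t).k)) :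
    ((firstTypeHolesZ τ L ε h βX βY βZ).card : ℝ) ≤
      (∑ t, ∑ g, if 0 < (leftProbes τ (pairTermIdx τ h) t g).card then
          holePoly c n * Real.exp (-((leftProbes τ (pairTermIdx τ h) t g).card * ε ^ 2 / 32)) else 0) *
        (levelBlocksZ (pairTermIdx τ h) (pairTermList c s βX βY βZ) 0).card := by
  have hmain := card_mergedHoles_le τ (pairTermIdx τ h) (deg := fun t => (L t).k) (γ := fun t => (L t).γZ) hε
    (deg' := fun idx => (pairTermList c s βX βY βZ idx).k) (β := fun idx => (pairTermList c s βX βY βZ idx).γZ)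
    (bar := starBar L) (fun u => by rw [pairTermList_pairTermIdx_k, pairTermList_pairTermIdx_k, hK])
    (pairTermIdx_natAdd_eq_starBar τ L h hI hJ hK)
    (fun t ht σ => by
      rw [hmix t ht]
      exact splitMixture_mul_card_eq_sum τ L h hI hJ hK βZ _ (fun t sidx => pairTermList_γZ_apply βX βY βZ t sidx) t ht σ)
  exact hmain

/-- **Uniform form, `Z`-dimension.** [cite: VassilevskaWilliamsXuXuZhou2024, §6.6] -/
theorem card_firstTypeHolesZ_le_of_le (hε : 0 < ε)
    (hI : ∀ u, I (Fin.castAdd n u) + I (Fin.natAdd n u) = (L (τ u)).i)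
    (hJ : ∀ u, J (Fin.castAdd n u) + J (Fin.natAdd n u) = (L (τ u)).j)
    (hK : ∀ u, K (Fin.castAdd n u) + K (Fin.natAdd n u) = (L (τ u)).k)
    (hmix : ∀ t, 0 < (termFibre τ t).card → (L t).γZ = splitMixture (constituentTriples c)
      (fun ijk => ((leftClass τ I J K t ijk.1 ijk.2.1 ijk.2.2).card : ℝ) / (termFibre τ t).card) (βZ t) ((L t).i, (L t).j, (L t).k))
    (m₀ : ℕ) (hm₀ : ∀ t i j k, 0 < (leftClass τ I J K t i j k).card → m₀ ≤ (leftClass τ I J K t i j k).card) :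
    ((firstTypeHolesZ τ L ε h βX βY βZ).card : ℝ) ≤
      (s : ℝ) * (s * (constituentTriples c).card : ℕ) * holePoly c n * Real.exp (-((m₀ : ℝ) * ε ^ 2 / 32)) *
        (levelBlocksZ (pairTermIdx τ h) (pairTermList c s βX βY βZ) 0).card := by
  have hmain := card_mergedHoles_le_of_le τ (pairTermIdx τ h) (deg := fun t => (L t).k) (γ := fun t => (L t).γZ) hε
    (deg' := fun idx => (pairTermList c s βX βY βZ idx).k) (β := fun idx => (pairTermList c s βX βY βZ idx).γZ)
    (bar := starBar L) (fun u => by rw [pairTermList_pairTermIdx_k, pairTermList_pairTermIdx_k, hK])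
    (pairTermIdx_natAdd_eq_starBar τ L h hI hJ hK)
    (fun t ht σ => by
      rw [hmix t ht]
      exact splitMixture_mul_card_eq_sum τ L h hI hJ hK βZ _ (fun t sidx => pairTermList_γZ_apply βX βY βZ t sidx) t ht σ)
    m₀ (le_card_leftProbes_of_le_card_leftClass τ h m₀ hm₀)
  exact hmain

end Bounds

end Literature.Computability.AlgebraicComplexity
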